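import Summits.KontsevichZagierPeriods.KontsevichZagierPeriods.Theorems.SymplecticScissorsPlanarCompilerStubSignedSweepAux
import Summits.KontsevichZagierPeriods.KontsevichZagierPeriods.Theorems.SymplecticScissorsPlanarCompilerStubSignedSweepAux6
import Summits.KontsevichZagierPeriods.KontsevichZagierPeriods.Theorems.SymplecticScissorsPlanarCompilerStubSignedSweepAux7
import Literature.ModelTheory.ExponentialFields.CylindricalDecompositionProofs
import Literature.ModelTheory.ExponentialFields.SemialgebraicDimension

/-!
# Signed sweep of the triangle, helper VIII: the strips

Helper file for the stub `stub_signedSweep` of the line `twist-restoring-shear` (crux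
`PlanarCompiler`, route `SymplecticScissors`). Given `ℚ`-semialgebraic `W, P, N ⊆ ℝ²` with
`T ∖ W` null (`T` the open triangle) we take a cylindrical decomposition of the plane adapted to
`{T, W, P, N}` and then a cylindrical decomposition of the line adapted to its base cells and to
the germ-type sets of all its sections; sorting the point cells in `(0, 1)` together with `0, 1`
gives strips `(x_s, x_{s+1})` over each of which the hypotheses of the sweep of one strip
(`stub_signedSweep_stripSweep`, helper V) hold: continuous `ℚ`-semialgebraic sections, each constant or
strictly monotone on the strip, whose graphs and bands cover the fibres and are adapted to
`T, W, P, N`.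
-/

noncomputable section

open MeasureTheory Set Filter Topology
open Literature.NumberTheory.Transcendental Literature.ModelTheory.ExponentialFields

namespace Summit.KontsevichZagierPeriods.SymplecticScissors.PlanarCompilerProof

/-- **The strips of the sweep.** See the module docstring; every point of `[0, 1]` is an end point
of a strip or lies in a strip. [folklore] -/
theorem stub_signedSweep_strips :
    ∀ {W P N : Set (Fin 2 → ℝ)}, IsSemialgebraic ℚ W → IsSemialgebraic ℚ P → IsSemialgebraic ℚ N →
    ∃ (k : ℕ) (x : Fin (k + 1) → ℝ), StrictMono x ∧ x 0 = 0 ∧ x (Fin.last k) = 1 ∧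
      (∀ t ∈ Icc (0 : ℝ) 1, (∃ i, x i = t) ∨ ∃ s : Fin k, t ∈ Ioo (x (Fin.castSucc s)) (x (Fin.succ s))) ∧
      ∀ s : Fin k, ∃ (n : ℕ) (ξ : Fin n → (Fin 1 → ℝ) → ℝ),
      (∀ j, ContinuousOn (ξ j) {z : Fin 1 → ℝ | z 0 ∈ Ioo (x (Fin.castSucc s)) (x (Fin.succ s))}) ∧
      (∀ j, IsSemialgebraicFunOn ℚ {z : Fin 1 → ℝ | z 0 ∈ Ioo (x (Fin.castSucc s)) (x (Fin.succ s))} (ξ j)) ∧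
      (∀ z : Fin 1 → ℝ, z 0 ∈ Ioo (x (Fin.castSucc s)) (x (Fin.succ s)) → StrictMono fun j => ξ j z) ∧
      (∀ j, (∃ c, EqOn (fun t : ℝ => ξ j (fun _ => t)) (fun _ => c) (Ioo (x (Fin.castSucc s)) (x (Fin.succ s)))) ∨
        StrictMonoOn (fun t : ℝ => ξ j (fun _ => t)) (Ioo (x (Fin.castSucc s)) (x (Fin.succ s))) ∨
        StrictAntiOn (fun t : ℝ => ξ j (fun _ => t)) (Ioo (x (Fin.castSucc s)) (x (Fin.succ s)))) ∧
      (∀ z : Fin 1 → ℝ, z 0 ∈ Ioo (x (Fin.castSucc s)) (x (Fin.succ s)) → ∀ t : ℝ,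
        (∃ j, t = ξ j z) ∨ ∃ j : Fin (n + 1), bandLower ξ j z < (t : EReal) ∧ (t : EReal) < bandUpper ξ j z) ∧
      (∀ j : Fin (n + 1),
        bandOver {z : Fin 1 → ℝ | z 0 ∈ Ioo (x (Fin.castSucc s)) (x (Fin.succ s))} ξ j ⊆
          {p : Fin 2 → ℝ | 0 < p 0 ∧ 0 < p 1 ∧ p 0 + p 1 < 1} ∨
        Disjoint (bandOver {z : Fin 1 → ℝ | z 0 ∈ Ioo (x (Fin.castSucc s)) (x (Fin.succ s))} ξ j)
          {p : Fin 2 → ℝ | 0 < p 0 ∧ 0 < p 1 ∧ p 0 + p 1 < 1}) ∧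
      (∀ j : Fin n,
        graphOver {z : Fin 1 → ℝ | z 0 ∈ Ioo (x (Fin.castSucc s)) (x (Fin.succ s))} (ξ j) ⊆
          {p : Fin 2 → ℝ | 0 < p 0 ∧ 0 < p 1 ∧ p 0 + p 1 < 1} ∨
        Disjoint (graphOver {z : Fin 1 → ℝ | z 0 ∈ Ioo (x (Fin.castSucc s)) (x (Fin.succ s))} (ξ j))
          {p : Fin 2 → ℝ | 0 < p 0 ∧ 0 < p 1 ∧ p 0 + p 1 < 1}) ∧
      (∀ j : Fin (n + 1), bandOver {z : Fin 1 → ℝ | z 0 ∈ Ioo (x (Fin.castSucc s)) (x (Fin.succ s))} ξ j ⊆ W ∨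
        Disjoint (bandOver {z : Fin 1 → ℝ | z 0 ∈ Ioo (x (Fin.castSucc s)) (x (Fin.succ s))} ξ j) W) ∧
      (∀ j : Fin (n + 1), bandOver {z : Fin 1 → ℝ | z 0 ∈ Ioo (x (Fin.castSucc s)) (x (Fin.succ s))} ξ j ⊆ P ∨
        Disjoint (bandOver {z : Fin 1 → ℝ | z 0 ∈ Ioo (x (Fin.castSucc s)) (x (Fin.succ s))} ξ j) P) ∧
      (∀ j : Fin (n + 1), bandOver {z : Fin 1 → ℝ | z 0 ∈ Ioo (x (Fin.castSucc s)) (x (Fin.succ s))} ξ j ⊆ N ∨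
        Disjoint (bandOver {z : Fin 1 → ℝ | z 0 ∈ Ioo (x (Fin.castSucc s)) (x (Fin.succ s))} ξ j) N) := by
  intro W P N hWsa hPsa hNsa
  classical
  set T : Set (Fin 2 → ℝ) := {p : Fin 2 → ℝ | 0 < p 0 ∧ 0 < p 1 ∧ p 0 + p 1 < 1} with hT
  have hTsa : IsSemialgebraic ℚ T := isSemialgebraic_triangles.2
  -- the cylindrical decomposition of the plane adapted to `T, W, P, N`
  set F : Finset (Set (Fin 2 → ℝ)) := {T, W, P, N} with hF
  have hFsa : ∀ s ∈ F, IsSemialgebraic ℚ s := by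
    intro s hs
    simp only [hF, Finset.mem_insert, Finset.mem_singleton] at hs
    rcases hs with rfl | rfl | rfl | rfl
    · exact hTsa
    · exact hWsa
    · exact hPsa
    · exact hNsa
  obtain ⟨𝒯, h𝒯, had⟩ := IsSemialgebraic.exists_cylindricalDecomposition_holds (k := ℚ) F hFsa
  have hadT := had T (by simp [hF])
  have hadW := had W (by simp [hF])
  have hadP := had P (by simp [hF])
  have hadN := had N (by simp [hF])
  obtain ⟨𝒮₁, h𝒮₁, l, ξ, hcont, hsa, hmono, hmem⟩ := h𝒯.2.2
  have h𝒯part := h𝒯.1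
  -- the sections extended by zero, their germ families
  set fS : (S : Set (Fin 1 → ℝ)) → Fin (l S) → ℝ → ℝ := fun S j t =>
    if ((fun _ : Fin 1 => t) : Fin 1 → ℝ) ∈ S then ξ S j (fun _ => t) else 0 with hfS
  have hfSsa : ∀ S ∈ 𝒮₁, ∀ j : Fin (l S),
      IsSemialgebraicFunOn ℚ (univ : Set (Fin 1 → ℝ)) (fun z => fS S j (z 0)) :=
    fun S hS j => isSemialgebraicFunOn_extendByZero (h𝒮₁.isSemialgebraic S hS) (hsa S hS j)
  have hgerm : ∀ S ∈ 𝒮₁, ∀ j : Fin (l S), ∃ 𝒢 : Finset (Set (Fin 1 → ℝ)),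
      (∀ G ∈ 𝒢, IsSemialgebraic ℚ G) ∧ ∀ u v : ℝ, u < v →
        (∀ G ∈ 𝒢, {z : Fin 1 → ℝ | z 0 ∈ Ioo u v} ⊆ G ∨ Disjoint {z : Fin 1 → ℝ | z 0 ∈ Ioo u v} G) →
        (∃ c, EqOn (fS S j) (fun _ => c) (Ioo u v)) ∨ StrictMonoOn (fS S j) (Ioo u v) ∨
          StrictAntiOn (fS S j) (Ioo u v) :=
    fun S hS j => stub_signedSweep_germFamily (fS S j) (hfSsa S hS j)
  choose! 𝒢 h𝒢sa h𝒢shape using hgerm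
  -- the cylindrical decomposition of the line adapted to the base cells and the germ sets
  set 𝓕 : Finset (Set (Fin 1 → ℝ)) :=
    𝒮₁ ∪ 𝒮₁.biUnion (fun S => (Finset.univ : Finset (Fin (l S))).biUnion fun j => 𝒢 S j) with h𝓕
  have h𝓕sa : ∀ s ∈ 𝓕, IsSemialgebraic ℚ s := by
    intro s hs
    rcases Finset.mem_union.1 hs with hs | hs
    · exact h𝒮₁.isSemialgebraic s hs
    · obtain ⟨S, hS, hs⟩ := Finset.mem_biUnion.1 hs
      obtain ⟨j, -, hs⟩ := Finset.mem_biUnion.1 hs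
      exact h𝒢sa S hS j s hs
  obtain ⟨𝒟, h𝒟, had𝒟⟩ := IsSemialgebraic.exists_cylindricalDecomposition_holds (k := ℚ) 𝓕 h𝓕sa
  -- the breakpoints: `0`, `1` and the point cells of `𝒟` inside `(0, 1)`
  set B : Finset ℝ := insert 0 (insert 1 ((finite_pointCells 𝒟).toFinset.filter fun c => 0 < c ∧ c < 1))
    with hB
  have h0B : (0 : ℝ) ∈ B := by simp [hB]
  have h1B : (1 : ℝ) ∈ B := by simp [hB]
  have hB01 : ∀ b ∈ B, 0 ≤ b ∧ b ≤ 1 := by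
    intro b hb
    simp only [hB, Finset.mem_insert, Finset.mem_filter, Set.Finite.mem_toFinset, mem_setOf_eq] at hb
    rcases hb with rfl | rfl | ⟨-, h1, h2⟩
    · exact ⟨le_rfl, zero_le_one⟩
    · exact ⟨zero_le_one, le_rfl⟩
    · exact ⟨h1.le, h2.le⟩
  have hptB : ∀ c : ℝ, {z : Fin 1 → ℝ | z 0 = c} ∈ 𝒟 → c ∈ Ioo (0 : ℝ) 1 → c ∈ B := by
    intro c hc hcI
    simp only [hB, Finset.mem_insert, Finset.mem_filter, Set.Finite.mem_toFinset, mem_setOf_eq]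
    exact Or.inr (Or.inr ⟨hc, hcI.1, hcI.2⟩)
  have hBsa : ∀ b ∈ B, IsSemialgebraic ℚ {z : Fin 1 → ℝ | z 0 = b} := by
    intro b hb
    simp only [hB, Finset.mem_insert, Finset.mem_filter, Set.Finite.mem_toFinset, mem_setOf_eq] at hb
    rcases hb with rfl | rfl | ⟨h, -, -⟩
    · exact isSemialgebraic_point_zero_one.1
    · exact isSemialgebraic_point_zero_one.2
    · exact h𝒟.isSemialgebraic _ h
  obtain ⟨k, x, hxmono, hx0, hxl, hxB, -, hstrip, hcov⟩ := stub_signedSweep_sortedStrips B h0B h1B hB01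
  refine ⟨k, x, hxmono, hx0, hxl, hcov, fun s => ?_⟩
  -- one strip
  set u := x (Fin.castSucc s) with hu'
  set v := x (Fin.succ s) with hv'
  have huv : u < v := hxmono Fin.castSucc_lt_succ
  have hu : 0 ≤ u := by rw [hu', ← hx0]; exact hxmono.monotone (Fin.zero_le _)
  have hv : v ≤ 1 := by rw [hv', ← hxl]; exact hxmono.monotone (Fin.le_last _)
  have hI01 : Ioo u v ⊆ Ioo 0 1 := fun t ht => ⟨hu.trans_lt ht.1, ht.2.trans_le hv⟩
  set S' : Set (Fin 1 → ℝ) := {z : Fin 1 → ℝ | z 0 ∈ Ioo u v} with hS'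
  have hS'sa : IsSemialgebraic ℚ S' := isSemialgebraic_strip_of_points (hBsa u (hxB _)) (hBsa v (hxB _))
  -- the strip lies in one cell `D` of `𝒟`, which lies in one base cell `S` of `𝒮₁`
  have hno : ∀ c : ℝ, {z : Fin 1 → ℝ | z 0 = c} ∈ 𝒟 → c ∉ Ioo u v :=
    fun c hc hcI => hstrip s c (hptB c hc (hI01 hcI)) hcI
  obtain ⟨D, hD, hS'D⟩ := exists_cell_strip_subset h𝒟 huv hno
  set z₀ : Fin 1 → ℝ := fun _ => (u + v) / 2 with hz₀
  have hz₀S' : z₀ ∈ S' := show (u + v) / 2 ∈ Ioo u v from ⟨by linarith, by linarith⟩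
  obtain ⟨S, ⟨hS, hz₀S⟩, -⟩ := h𝒮₁.isPartition.2 z₀
  have hS𝓕 : S ∈ 𝓕 := Finset.mem_union_left _ hS
  have hDS : D ⊆ S := by
    rcases h𝒟.subset_or_disjoint (had𝒟 S hS𝓕) hD with h | h
    · exact h
    · exact absurd hz₀S (Set.disjoint_left.1 h (hS'D hz₀S'))
  have hS'S : S' ⊆ S := hS'D.trans hDS
  -- adaptedness of the cells over `S'`
  have hadapt : ∀ {X : Set (Fin 2 → ℝ)}, (∃ 𝒞 ⊆ 𝒯, ⋃₀ (𝒞 : Set (Set (Fin 2 → ℝ))) = X) →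
      (∀ j : Fin (l S + 1), bandOver S' (ξ S) j ⊆ X ∨ Disjoint (bandOver S' (ξ S) j) X) ∧
      (∀ j : Fin (l S), graphOver S' (ξ S j) ⊆ X ∨ Disjoint (graphOver S' (ξ S j)) X) := by
    intro X hX
    constructor
    · intro j
      have hmemT : bandOver S (ξ S) j ∈ 𝒯 := (hmem _).2 ⟨S, hS, Or.inr ⟨j, rfl⟩⟩
      exact subset_or_disjoint_of_subset (bandOver_mono hS'S (ξ S) j) (h𝒯.subset_or_disjoint hX hmemT)
    · intro j
      have hmemT : graphOver S (ξ S j) ∈ 𝒯 := (hmem _).2 ⟨S, hS, Or.inl ⟨j, rfl⟩⟩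
      exact subset_or_disjoint_of_subset (graphOver_mono hS'S (ξ S j)) (h𝒯.subset_or_disjoint hX hmemT)
  -- the fibres over `S'` are covered by the graphs and bands over `S`
  have hpart : ∀ z : Fin 1 → ℝ, z 0 ∈ Ioo u v → ∀ t : ℝ,
      (∃ j, t = ξ S j z) ∨ ∃ j : Fin (l S + 1),
        bandLower (ξ S) j z < (t : EReal) ∧ (t : EReal) < bandUpper (ξ S) j z := by
    intro z hz t
    obtain ⟨D₂, ⟨hD₂, hqD₂⟩, -⟩ := h𝒯part.2 (Fin.snoc z t : Fin 2 → ℝ)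
    obtain ⟨S'', hS'', hD₂eq⟩ := (hmem D₂).1 hD₂
    have hzS'' : z ∈ S'' := by
      rcases hD₂eq with ⟨j, rfl⟩ | ⟨j, rfl⟩
      · exact (snoc_mem_graphOver_iff.1 hqD₂).1
      · exact (snoc_mem_bandOver_iff.1 hqD₂).1
    obtain ⟨b, -, huniq⟩ := h𝒮₁.isPartition.2 z
    have hSS : S'' = S := (huniq S'' ⟨hS'', hzS''⟩).trans (huniq S ⟨hS, hS'S hz⟩).symm
    subst hSS
    rcases hD₂eq with ⟨j, rfl⟩ | ⟨j, rfl⟩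
    · exact Or.inl ⟨j, (snoc_mem_graphOver_iff.1 hqD₂).2⟩
    · exact Or.inr ⟨j, (snoc_mem_bandOver_iff.1 hqD₂).2⟩
  -- the shape of each section on the strip
  have hshape : ∀ j : Fin (l S), (∃ c, EqOn (fun t : ℝ => ξ S j (fun _ => t)) (fun _ => c) (Ioo u v)) ∨
      StrictMonoOn (fun t : ℝ => ξ S j (fun _ => t)) (Ioo u v) ∨
      StrictAntiOn (fun t : ℝ => ξ S j (fun _ => t)) (Ioo u v) := by
    intro j
    have heq : EqOn (fS S j) (fun t : ℝ => ξ S j (fun _ => t)) (Ioo u v) := by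
      intro t ht
      have : ((fun _ : Fin 1 => t) : Fin 1 → ℝ) ∈ S := hS'S ht
      simp [hfS, this]
    have hadG : ∀ G ∈ 𝒢 S j, S' ⊆ G ∨ Disjoint S' G := by
      intro G hG
      have hG𝓕 : G ∈ 𝓕 := by
        refine Finset.mem_union_right _ (Finset.mem_biUnion.2 ⟨S, hS, Finset.mem_biUnion.2 ⟨j, ?_, hG⟩⟩)
        exact Finset.mem_univ _
      exact subset_or_disjoint_of_subset hS'D (h𝒟.subset_or_disjoint (had𝒟 G hG𝓕) hD)
    rcases h𝒢shape S hS j u v huv hadG with ⟨c, hc⟩ | h | h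
    · exact Or.inl ⟨c, heq.symm.trans hc⟩
    · exact Or.inr (Or.inl (h.congr heq))
    · exact Or.inr (Or.inr (h.congr heq))
  exact ⟨l S, ξ S, fun j => (hcont S hS j).mono hS'S, fun j => (hsa S hS j).mono hS'S hS'sa,
    fun z hz => hmono S hS z (hS'S hz), hshape, hpart, (hadapt hadT).1, (hadapt hadT).2, (hadapt hadW).1,
    (hadapt hadP).1, (hadapt hadN).1⟩

end Summit.KontsevichZagierPeriods.SymplecticScissors.PlanarCompilerProof
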